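import Literature.NumberTheory.GaloisRepresentations.WeilLAdicCharacterDeRham
import Literature.NumberTheory.GaloisRepresentations.AlgebraicHeckeCharacterPurity
import Literature.NumberTheory.GaloisRepresentations.InducedGaloisRep
import Literature.NumberTheory.GaloisRepresentations.LabelledHodgeTateWeights
import HarnessLib

/-!
# De Rham-ness and Hodge–Tate weights of induced `ℓ`-adic representations (Patrikis 2019, Lemma 7.2.1 — named facts)

Topic `NumberTheory/PAdicHodge`; namespace `Literature.NumberTheory.PAdicHodge`.  Two named facts
(D-0014, `def X : Prop`, cited) about the induction `Ind_{Γ_K}^{Γ_ℚ} θ` (`FramedGaloisRep.induce`) of a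
framed `ℓ`-adic representation `θ` of a number field `K`, relative to Fontaine's PINNED data of the
summit `Langlands` (`fontainePstAdicCompletion v ℓ hv`):

* `isDeRhamFramed_of_isDeRhamFramed_induce` — if `Ind θ` is de Rham at every `v ∣ ℓ` then `θ` is de
  Rham at every `w ∣ ℓ` (Patrikis, Lemma 7.2.1: "`V = Ind_L^K W` … is de Rham if and only if `W` is",
  with Mackey `(Ind_K^ℚ θ)|_{Γ_{ℚ_ℓ}} ≅ ⊕_{w ∣ ℓ} Ind_{K_w}^{ℚ_ℓ} θ|_{Γ_{K_w}}` and stability of de Rham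
  representations under direct summands, Brinon–Conrad Thm. 5.2.1);
* `labelledHodgeTateWeightsAt_induce_of_parallel` — for a CHARACTER `θ` corresponding to a Hecke
  character of infinity type `(p, q)` all of whose embedding exponents are equal, the labelled
  Hodge–Tate weights of `Ind θ` at every `v ∣ ℓ` are parallel, `{m, …, m}` (Patrikis, proof of
  Cor. 2.2.3: `HT_τ(ψ̂) = k_τ` for `ψ_v = ι_v^{k_{τ*(ι_v)}} ῑ_v^{k_{τ*(ῑ_v)}}`; Lemma 2.2.4; Lemma 7.2.1:
  `D_dR(Ind W)` is `D_dR(W)` with the labels forgotten; Serre 1968, Ch. III §1.1 and A.5).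

Both are stated in the sign-free / one-directional special form consumed by the crux
`DyadicOddResidue.DyadicEisensteinFM` (stmt-Langlands-18741, stub `stub_cmTateTwistNewform`: the CM leg
of Fontaine–Mazur for `GL₂/ℚ` at `ℓ = 2`, helper
`Summits/Langlands/Langlands/Theorems/DyadicOddResidueDyadicEisensteinFMStubCmTateTwistNewform.lean`),
with `-- TODO(general form)` lines recording the printed generality.

## References

* S. Patrikis, *Variations on a theorem of Tate*, Mem. Amer. Math. Soc. 258 (2019), no. 1238
  (arXiv:1207.6724): Ch. 2 §2.2 (Prop. 2.2.1, Cor. 2.2.3, Lemma 2.2.4), §7.2 Lemma 7.2.1. [Patrikis2019]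
* O. Brinon, B. Conrad, *CMI Summer School notes on p-adic Hodge theory* (2009), Thm. 5.2.1,
  Prop. 6.3.8. [BrinonConrad2009]
* J.-P. Serre, *Abelian ℓ-adic representations and elliptic curves* (1968), Ch. III §1.1, App. A.5.
  [SerreAbelianLadic1968]

`lean search 'isDeRhamFramed_of_isDeRhamFramed_induce|labelledHodgeTateWeightsAt_induce'` (2026-08-17): no
prior declaration.
-/

noncomputable section

open scoped NumberField Polynomial
open NumberField IsDedekindDomain Field Polynomial Filter
open Literature.NumberTheory.GaloisRepresentations

namespace Literature.NumberTheory.PAdicHodge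

/-- **De Rham-ness descends from an induced representation to the inducing one** (Patrikis 2019,
Lemma 7.2.1: "Let `L/K/ℚ_ℓ` be finite, and let `W` be a de Rham representation of `Γ_L`. Then
`V = Ind_L^K W` is also de Rham, and `D_dR(V)` is the image under the forgetful functor `Fil_L → Fil_K`
of `D_dR(W)` […] Comparing dimensions, it is clear that `V` is de Rham if and only if `W` is";
globally, by Mackey, `(Ind_{Γ_K}^{Γ_ℚ} θ)|_{Γ_{ℚ_ℓ}} ≅ ⊕_{w ∣ ℓ} Ind_{K_w}^{ℚ_ℓ}(θ|_{Γ_{K_w}})`, and a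
direct summand of a de Rham representation is de Rham, Brinon–Conrad Thm. 5.2.1).  Vendored, for
Fontaine's PINNED data of the summit (`fontainePstAdicCompletion`): for a number field `K` of degree
`d`, a prime `ℓ` and a framed `θ : Γ_K → GL_n(ℚ̄_ℓ)`, if `Ind_{Γ_K}^{Γ_ℚ} θ` (`FramedGaloisRep.induce`)
is de Rham at every place `v ∣ ℓ` of `ℚ`, then `θ` is de Rham at every place `w ∣ ℓ` of `K`.
-- TODO(general form): the converse, the formula `D_dR(Ind W) = forget D_dR(W)` with the labelled Hodge–Tate weights, and an arbitrary base number field in place of `ℚ`.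
[cite: Patrikis2019, Lemma 7.2.1 (Ch. 2 §7.2, numbering of arXiv:1207.6724)]
[cite: BrinonConrad2009, Thm. 5.2.1 and Prop. 6.3.8] -/
def isDeRhamFramed_of_isDeRhamFramed_induce : Prop :=
  ∀ (K : Type) [Field K] [NumberField K] (d : ℕ) (hd : Module.finrank ℚ K = d) (ℓ : ℕ) [Fact ℓ.Prime]
    (n : ℕ) (θ : FramedGaloisRep K (PadicAlgCl ℓ) n),
    (∀ (v : HeightOneSpectrum (𝓞 ℚ)) (hv : ((ℓ : ℕ) : 𝓞 ℚ) ∈ v.asIdeal),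
      (fontainePstAdicCompletion v ℓ hv).IsDeRhamFramed ((θ.induce ℚ hd).toLocal v)) →
    ∀ (w : HeightOneSpectrum (𝓞 K)) (hw : ((ℓ : ℕ) : 𝓞 K) ∈ w.asIdeal),
      (fontainePstAdicCompletion w ℓ hw).IsDeRhamFramed (θ.toLocal w)


/-- Unfolding lemma for `isDeRhamFramed_of_isDeRhamFramed_induce` (the shape consumers destructure).
[folklore] -/
theorem isDeRhamFramed_of_isDeRhamFramed_induce_iff :
    isDeRhamFramed_of_isDeRhamFramed_induce ↔
      ∀ (K : Type) [Field K] [NumberField K] (d : ℕ) (hd : Module.finrank ℚ K = d) (ℓ : ℕ)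
        [Fact ℓ.Prime] (n : ℕ) (θ : FramedGaloisRep K (PadicAlgCl ℓ) n),
        (∀ (v : HeightOneSpectrum (𝓞 ℚ)) (hv : ((ℓ : ℕ) : 𝓞 ℚ) ∈ v.asIdeal),
          (fontainePstAdicCompletion v ℓ hv).IsDeRhamFramed ((θ.induce ℚ hd).toLocal v)) →
        ∀ (w : HeightOneSpectrum (𝓞 K)) (hw : ((ℓ : ℕ) : 𝓞 K) ∈ w.asIdeal),
          (fontainePstAdicCompletion w ℓ hw).IsDeRhamFramed (θ.toLocal w) :=
  Iff.rfl

/-- **Induced characters with parallel exponents have parallel labelled Hodge–Tate weights**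
(Patrikis 2019: proof of Cor. 2.2.3 — for the `ℓ`-adic character `ψ̂` of a type-`A₀` Hecke character
`ψ` with `ψ_v(x_v) = ι_v(x_v)^{k_{τ*(ι_v)}} ῑ_v(x_v)^{k_{τ*(ῑ_v)}}` one has `HT_τ(ψ̂) = k_τ`, the label
`τ : K → ℚ̄_ℓ` and the embedding `τ*` being matched by `ι_ℓ, ι_∞` —, Lemma 2.2.4 (all weights equal over
a totally real field) and Lemma 7.2.1 (`D_dR(Ind W)` is `D_dR(W)` with the labels forgotten, so
`HT_τ(Ind_K^ℚ θ) = ⊔_{τ̃ ∣ τ} HT_τ̃(θ)`, `[K : ℚ]` weights in all); Serre 1968, Ch. III §1.1 and A.5).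
Vendored as the sign-free special case the summit needs, for Fontaine's pinned data: let `K` be a
number field of degree `d`, `θ : Γ_K → GL₁(ℚ̄_ℓ)` a continuous character corresponding (via
`ι : ℚ̄_ℓ ≃ ℂ`, at all but finitely many places, in the tree's normalisation
`θ(Frob_w) = ι⁻¹(χ(ϖ_w))⁻¹`) to a Hecke character `χ` of infinity type `(p, q)` all of whose embedding
exponents `n_φ` (`HeckeCharacter.embExponent p q φ`, `φ : K → ℂ`) are EQUAL.  Then there is one integer
`m` such that for every place `v ∣ ℓ` of `ℚ` and every continuous label `τ : ℚ_v → ℚ̄_ℓ`, the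
`τ`-labelled Hodge–Tate weights of `Ind_{Γ_K}^{Γ_ℚ} θ` at `v` are `{m, …, m}` (`d` times).
-- TODO(general form): `HT_τ(Ind_K^ℚ θ)` at `v` is the multiset of the exponents `-n_φ` over the embeddings `φ` inducing the pairs `(w ∣ v, τ̃ ∣ τ)` (Patrikis Lemma 7.2.1 with Serre III §1.1), for an arbitrary infinity type.
[cite: Patrikis2019, Cor. 2.2.3 (proof), Lemma 2.2.4 and Lemma 7.2.1 (numbering of arXiv:1207.6724)]
[cite: SerreAbelianLadic1968, Ch. III §1.1 and App. A.5] -/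
def labelledHodgeTateWeightsAt_induce_of_parallel : Prop :=
  ∀ (K : Type) [Field K] [NumberField K] (d : ℕ) (hd : Module.finrank ℚ K = d) (ℓ : ℕ) [Fact ℓ.Prime]
    (θ : FramedGaloisRep K (PadicAlgCl ℓ) 1) (ι : PadicAlgCl ℓ ≃+* ℂ) (χ : HeckeCharacter K)
    (p q : InfinitePlace K → ℤ), χ.HasInfinityType p q →
    (∀ᶠ w : HeightOneSpectrum (𝓞 K) in cofinite,
      θ.HasFrobCharpolyAt w (X - C (ι.symm (χ.valueAtUniformizer w)⁻¹))) →
    ∀ n₀ : ℤ, (∀ φ : K →+* ℂ, HeckeCharacter.embExponent p q φ = n₀) →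
    ∃ m : ℤ, ∀ (v : HeightOneSpectrum (𝓞 ℚ)) (hv : ((ℓ : ℕ) : 𝓞 ℚ) ∈ v.asIdeal)
      (τ : v.adicCompletion ℚ →+* PadicAlgCl ℓ), Continuous τ →
      (θ.induce ℚ hd).labelledHodgeTateWeightsAt v (fontainePstAdicCompletion v ℓ hv).algebra
        (fontainePstAdicCompletion v ℓ hv).𝔅 τ = Multiset.replicate d m


/-- **Consequence (sanity of the shape)**: granting the fact, parallel exponents force the labelled
weights of `Ind θ` at any `v ∣ ℓ` to be NOT multiplicity-free as soon as `[K : ℚ] ≥ 2` — the form in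
which the crux `DyadicEisensteinFM` consumes it (its hypothesis is `Nodup`). [folklore] -/
theorem not_nodup_labelledHodgeTateWeightsAt_induce_of_parallel
    (h : labelledHodgeTateWeightsAt_induce_of_parallel) {K : Type} [Field K] [NumberField K] {d : ℕ}
    (hd : Module.finrank ℚ K = d) (h2 : 2 ≤ d) {ℓ : ℕ} [Fact ℓ.Prime]
    (θ : FramedGaloisRep K (PadicAlgCl ℓ) 1) (ι : PadicAlgCl ℓ ≃+* ℂ) (χ : HeckeCharacter K)
    (p q : InfinitePlace K → ℤ) (hχ : χ.HasInfinityType p q)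
    (hθ : ∀ᶠ w : HeightOneSpectrum (𝓞 K) in cofinite,
      θ.HasFrobCharpolyAt w (X - C (ι.symm (χ.valueAtUniformizer w)⁻¹)))
    (n₀ : ℤ) (hn : ∀ φ : K →+* ℂ, HeckeCharacter.embExponent p q φ = n₀)
    (v : HeightOneSpectrum (𝓞 ℚ)) (hv : ((ℓ : ℕ) : 𝓞 ℚ) ∈ v.asIdeal)
    (τ : v.adicCompletion ℚ →+* PadicAlgCl ℓ) (hτ : Continuous τ) :
    ¬ ((θ.induce ℚ hd).labelledHodgeTateWeightsAt v (fontainePstAdicCompletion v ℓ hv).algebra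
        (fontainePstAdicCompletion v ℓ hv).𝔅 τ).Nodup := by
  obtain ⟨m, hm⟩ := h K d hd ℓ θ ι χ p q hχ hθ n₀ hn
  rw [hm v hv τ hτ, Multiset.nodup_iff_count_le_one]
  intro hc
  have := hc m
  rw [Multiset.count_replicate_self] at this
  omega

end Literature.NumberTheory.PAdicHodge

end
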